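import Summits.ResolutionOfSingularities.ResolutionOfSingularities.Theorems.EquisingularLiftEquisingularLiftNatTowerReachLettersDefs
import HarnessLib

/-!
# [OURS · L1 W4.5(b) · EL♮(3) · T23-A⁵ «NEST»] THE FIFTH GENERATING STEP OF THE PREFIX REACH: `TowerNestB₅`, `ReachTowerBQuintPrime`

WIDTH TABLE D3 «NEST» (desk RULING R39, 2026-08-28), brick D3-1 (res-L1-w45b-stub-4 g11, A-engine owner): the DOWNSTAIRS Defs module of the move «NEST» of
res-L1-w45b-lead-1's (m5)-v3 customer S10 (memo `RESIDUE-CUSTOMER-S10.md` §4(ii)): after an in-carrier point step at a point `y`, ONE Δ-round whose centre is an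
irreducible regular curve `Z` INSIDE THE FRESH EXCEPTIONAL PLANE `υ₂⁻¹{y}` (for S10: the conic `E_q ∩ St W_q` of the exact quadric cone at `q`).
`--supports stmt-ResolutionOfSingularities-20148`, no claim, counted 0.  AI-produced; NOT a statement of [Hironaka2017]; EL♮(3) is NOT proved here; names FINAL
(R39 (iii): the typed text wins).

WHAT.
* `TowerNestB₅ F₁₀ R` — ONE COMBINED generating step in the reach currency `R G γ T E Es Ns K` (arity unchanged, so `TowerPtRegB₄` / `TowerPtRamB₄` /
  `TowerRoundBTriplePrime` ✓ p627089 are reused verbatim): the in-carrier point step at `y` with `TowerPtRegB₄`'s hypotheses VERBATIM (`y` non-regular on `T̄`,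
  ambient regular at `y`, `υ₂ = Bl_y`, its `K'`/`Es'`/`Ns'` menus) but the running surface FORCED to the fresh plane `E' = υ₂⁻¹{y}` — this makes «`E` fresh»
  DEFINITIONAL — followed by the Δ-round `υ₃ = Bl_Z` at an irreducible curve `Z ⊆ E' ∩ T'` with EXACTLY the hypotheses of res-type-027's embedded-round closure
  `Tower.invB₄_embRound_of_fact_anyPrime` (✓ `…NatTowerBFourRoundOfFact`, host `H = E'`, shadow `KH = K'`): `Z̃` regular, `Ẽ'` regular along `Z̃`,
  `DirStepUnobs G' E' _ Z _`, `Z̃` a curve at its closed points (residue-side clauses certified per specimen, R39 (i)), and its `K''`/`E''`/`Es''`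
  (`RoundTransportOKPrime`)/`Ns''` menus — so the UPSTAIRS NEST case is the composition «`Tower.towerPtRegB₄_invB₁_FE` (p627628) then
  `Tower.invB₄_embRound_of_fact_anyPrime`», no new upstairs brick.
* `ReachTowerBQuintPrime F₁ F₂ υ x T₂ Ls₂ F' β T'` — `ReachTowerBQuadPrime` ✓ p634442 with `TowerNestB₅ F₁₀ R →` added to the `∀ R` closure (prefix⁵).
* `reachTowerBQuintPrime_of_quad` — monotonicity prefix⁴ ⊆ prefix⁵ (pure logic).
-/

set_option linter.dupNamespace false

noncomputable section

open CategoryTheory AlgebraicGeometry TopologicalSpace Topology IsLocalRing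
open Literature.AlgebraicGeometry.Resolution
open AlgebraicGeometry.Scheme.IdealSheafData
open Summit.ResolutionOfSingularities.ResolutionOfSingularities.Theses.EquisingularLift.Split
open Summit.ResolutionOfSingularities.ResolutionOfSingularities.Cruxes.EquisingularLift.StrataSplit

namespace Summit.ResolutionOfSingularities.ResolutionOfSingularities.Cruxes.EquisingularLiftNat.Sections

/-- **TOWER-B⁵ / (nest)** — the in-carrier point step at `y` (hypotheses of `TowerPtRegB₄` verbatim, running surface forced to the fresh plane
`E' = υ₂⁻¹{y}`) FOLLOWED BY the Δ-round at an irreducible regular curve `Z` inside `E'` (branch-1 side clauses of `TowerRoundBTriplePrime`, host = witness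
= `E'`), as ONE generating step of the reach closure. [OURS · T23-A⁵ Defs · res-L1-w45b-stub-4 g11, WIDTH TABLE D3 brick D3-1] -/
def TowerNestB₅ (F₁₀ : Scheme.{0})
    (R : ∀ G : Scheme.{0}, (G ⟶ F₁₀) → Set G → Set G → List (Set G) → List (Set G) → Set G → Prop) : Prop :=
  ∀ (G G' G'' : Scheme.{0}) (γ : G ⟶ F₁₀) (T E : Set G) (Es Ns : List (Set G)) (K : Set G) (y : redSub G (closure T) isClosed_closure)
      (υ₂ : G' ⟶ G) (hy : IsClosed ({curvePt G T y} : Set G)) (K' : Set G') (E' : Set G') (hE' : IsClosed E') (Es' Ns' : List (Set G'))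
      (Z : Set G') (hZ : IsClosed Z) (υ₃ : G'' ⟶ G') (K'' : Set G'') (E'' : Set G'') (Es'' Ns'' : List (Set G'')),
    R G γ T E Es Ns K →
    -- (1) the in-carrier point step at `y` (= `TowerPtRegB₄`'s hypotheses; running surface := the fresh plane)
    ¬ IsRegularLocalRing ((redSub G (closure T) isClosed_closure).presheaf.stalk y) →
    IsRegularLocalRing (G.presheaf.stalk (curvePt G T y)) →
    IsBlowup υ₂ (Scheme.IdealSheafData.vanishingIdeal (⟨{curvePt G T y}, hy⟩ : Closeds G)) →
    (K' = ∅ ∨ (curvePt G T y ∉ closure K ∧ K' = closure (υ₂ ⁻¹' (K \ {curvePt G T y})))) →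
    E' = υ₂ ⁻¹' {curvePt G T y} →
    (∀ F' ∈ Es', (∃ F ∈ E :: Es, curvePt G T y ∉ F ∧ F' = closure (υ₂ ⁻¹' (F \ {curvePt G T y}))) ∨ F' = υ₂ ⁻¹' {curvePt G T y}) →
    (∀ F' ∈ Ns', (∃ F ∈ (E :: Es) ++ Ns, F' = closure (υ₂ ⁻¹' (F \ {curvePt G T y}))) ∨ F' = υ₂ ⁻¹' {curvePt G T y}) →
    -- (2) the Δ-round at an irreducible regular curve `Z` inside the fresh plane, E1-legal for the strict transform
    Z ⊆ E' ∩ closure (υ₂ ⁻¹' (T \ {curvePt G T y})) → Z.Nonempty → IsIrreducible Z →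
    (∀ x : redSub G' Z hZ, IsRegularLocalRing ((redSub G' Z hZ).presheaf.stalk x)) →
    (∀ (i : redSub G' Z hZ ⟶ redSub G' E' hE'), i ≫ redSubι G' E' hE' = redSubι G' Z hZ →
      ∀ x : redSub G' Z hZ, IsRegularLocalRing ((redSub G' E' hE').presheaf.stalk (i x))) →
    DirStepUnobs G' E' hE' Z hZ →
    (∀ z : ↥(redSub G' Z hZ), IsClosed ({z} : Set ↥(redSub G' Z hZ)) → ringKrullDim ((redSub G' Z hZ).presheaf.stalk z) = ((1 : ℕ) : WithBot ℕ∞)) →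
    IsBlowup υ₃ (Scheme.IdealSheafData.vanishingIdeal (⟨Z, hZ⟩ : Closeds G')) →
    (K'' = ∅ ∨ (closure (Z \ closure K') = Z ∧ K'' = closure (υ₃ ⁻¹' (K' \ Z)))) →
    (E'' = υ₃ ⁻¹' Z ∨ E'' = closure (υ₃ ⁻¹' (E' \ Z))) →
    (∀ F'' ∈ Es'', ∃ F ∈ E' :: Es', RoundTransportOKPrime υ₃ Z hZ E' F F'') →
    (∀ F'' ∈ Ns'', ∃ F : Set G', (F ∈ Ns' ∨ F ∈ E' :: Es') ∧ F'' = closure (υ₃ ⁻¹' (F \ Z))) →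
    R G'' (υ₃ ≫ υ₂ ≫ γ) (closure (υ₃ ⁻¹' (closure (υ₂ ⁻¹' (T \ {curvePt G T y})) \ Z))) E'' Es'' Ns'' K''

/-- **`ReachTowerBQuintPrime` — the A⁵ PREFIX REACH** (`ReachTowerBQuadPrime` ✓ p634442 with the NEST step added to the closure): the A″ part
`InCarrierReachKSs`, the B‴ round `υ'`, then every motive `R` closed under `TowerPtRegB₄`, `TowerPtRamB₄`, `TowerRoundBTriplePrime` AND `TowerNestB₅` holds at
`(F', γ', T', E', Es', Ns', K')`. [OURS · T23-A⁵ Defs] -/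
def ReachTowerBQuintPrime (F₁ F₂ : Scheme.{0}) (υ : F₂ ⟶ F₁) (x : F₁) (T₂ : Set F₂) (Ls₂ : List (Set F₂)) (F' : Scheme.{0}) (β : F' ⟶ F₂)
    (T' : Set F') : Prop :=
  ∃ (W : Set F₁) (K₂ : Set F₂) (F₉ : Scheme.{0}) (β₉ : F₉ ⟶ F₂) (T₉ Z₉ K₉ S₉ : Set F₉) (Ps₉ Ms₉ : List (Set F₉)) (b₉ : Bool) (hZ₉ : IsClosed Z₉)
    (F₁₀ : Scheme.{0}) (υ' : F₁₀ ⟶ F₉) (Es₁₀ Ns₁₀ : List (Set F₁₀)) (γ' : F' ⟶ F₁₀) (E' : Set F') (Es' Ns' : List (Set F')) (K' : Set F'),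
    x ∈ W ∧ ¬ (υ ⁻¹' {x} ⊆ closure (υ ⁻¹' (W \ {x}))) ∧
    (∃ U : F₁.affineOpens, x ∈ (U : F₁.Opens) ∧
      ((Scheme.IdealSheafData.vanishingIdeal (⟨closure W, isClosed_closure⟩ : Closeds F₁)).ideal U).IsPrincipal) ∧
    υ ⁻¹' {x} ∩ closure (υ ⁻¹' (W \ {x})) ⊆ T₂ ∧
    (K₂ = ∅ ∨ (ConeForm F₁ x W ∧ K₂ = closure (υ ⁻¹' (W \ {x})))) ∧
    InCarrierReachKSs F₂ T₂ (υ ⁻¹' {x} ∩ closure (υ ⁻¹' (W \ {x}))) K₂ (υ ⁻¹' {x}) Ls₂ [] F₉ β₉ T₉ Z₉ K₉ S₉ Ps₉ Ms₉ b₉ ∧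
    Z₉ ⊆ T₉ ∧ ¬ (T₉ ⊆ Z₉) ∧ Z₉.Infinite ∧
    Set.Finite {z : redSub F₉ Z₉ hZ₉ | ¬ IsRegularLocalRing ((redSub F₉ Z₉ hZ₉).presheaf.stalk z)} ∧
    IsBlowup υ' (Scheme.IdealSheafData.vanishingIdeal (⟨Z₉, hZ₉⟩ : Closeds F₉)) ∧
    (∀ F ∈ Es₁₀, F = closure (υ' ⁻¹' (S₉ \ Z₉)) ∨
      ∃ P ∈ Ps₉, ∃ hP : IsClosed P,
        (∀ g ∈ Z₉ ∩ P, stalkIdeal (vanishingIdeal (⟨Z₉, hZ₉⟩ : Closeds F₉)) g ⊔ stalkIdeal (vanishingIdeal (⟨P, hP⟩ : Closeds F₉)) g =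
            maximalIdeal (F₉.presheaf.stalk g)) ∧
        (∀ g ∈ Z₉ ∩ P, stalkIdeal (vanishingIdeal (⟨Z₉, hZ₉⟩ : Closeds F₉)) g ≠ maximalIdeal (F₉.presheaf.stalk g)) ∧
        F = closure (υ' ⁻¹' (P \ Z₉))) ∧
    (∀ F ∈ Ns₁₀, ∃ P ∈ Ps₉ ++ Ms₉, F = closure (υ' ⁻¹' (P \ Z₉))) ∧
    (∀ R : (∀ G : Scheme.{0}, (G ⟶ F₁₀) → Set G → Set G → List (Set G) → List (Set G) → Set G → Prop),
      R F₁₀ (𝟙 F₁₀) (closure (υ' ⁻¹' (T₉ \ Z₉))) (υ' ⁻¹' Z₉) Es₁₀ Ns₁₀ (closure (υ' ⁻¹' (K₉ \ Z₉))) →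
      TowerPtRegB₄ F₁₀ R → TowerPtRamB₄ F₁₀ R → TowerRoundBTriplePrime F₉ F₁₀ υ' Z₉ hZ₉ R → TowerNestB₅ F₁₀ R → R F' γ' T' E' Es' Ns' K') ∧
    β = (γ' ≫ υ') ≫ β₉

/-- **Monotonicity prefix⁴ ⊆ prefix⁵**: an A⁗-reach end is an A⁵-reach end (more closure hypotheses on the motive). [OURS · pure logic] -/
theorem reachTowerBQuintPrime_of_quad (F₁ F₂ : Scheme.{0}) (υ : F₂ ⟶ F₁) (x : F₁) (T₂ : Set F₂) (Ls₂ : List (Set F₂)) (F' : Scheme.{0})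
    (β : F' ⟶ F₂) (T' : Set F') (h : ReachTowerBQuadPrime F₁ F₂ υ x T₂ Ls₂ F' β T') :
    ReachTowerBQuintPrime F₁ F₂ υ x T₂ Ls₂ F' β T' := by
  obtain ⟨W, K₂, F₉, β₉, T₉, Z₉, K₉, S₉, Ps₉, Ms₉, b₉, hZ₉, F₁₀, υ', Es₁₀, Ns₁₀, γ', E', Es', Ns', K', h1, h2, h3, h4, h5, h6, h7, h8, h9, h10, h11, h12,
    h13, hR, hβ⟩ := h
  exact ⟨W, K₂, F₉, β₉, T₉, Z₉, K₉, S₉, Ps₉, Ms₉, b₉, hZ₉, F₁₀, υ', Es₁₀, Ns₁₀, γ', E', Es', Ns', K', h1, h2, h3, h4, h5, h6, h7, h8, h9, h10, h11, h12, h13,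
    fun R h0 hreg hram hround _ => hR R h0 hreg hram hround, hβ⟩

/-- No letters and no NEST: the A‴ chain implies the A⁵ reach (definitional + monotonicity). [OURS · pure logic] -/
theorem reachTowerBQuintPrime_of_triple (F₁ F₂ : Scheme.{0}) (υ : F₂ ⟶ F₁) (x : F₁) (T₂ : Set F₂) (F' : Scheme.{0}) (β : F' ⟶ F₂) (T' : Set F')
    (h : ReachTowerBTriplePrime F₁ F₂ υ x T₂ F' β T') : ReachTowerBQuintPrime F₁ F₂ υ x T₂ [] F' β T' :=
  reachTowerBQuintPrime_of_quad F₁ F₂ υ x T₂ [] F' β T' ((reachTowerBQuadPrime_nil_iff F₁ F₂ υ x T₂ F' β T').mpr h)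

end Summit.ResolutionOfSingularities.ResolutionOfSingularities.Cruxes.EquisingularLiftNat.Sections

end
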